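import Summits.QuantumFields.GaugeBoot.BaryonThetaObservable
import Summits.QuantumFields.GaugeBoot.FrameLowerSlab
import Summits.QuantumFields.GaugeBoot.TiltedLinkRPPositivity
import HarnessLib

/-!
# The baryonic witness against link reflection positivity at `β < 0`: geometry in the layer `1` of a site frame (gauge-boot, L3 negative supplement; SU(3) link reflection at `β < 0`, part 6)

HONEST FRAMING (cell `pub-gaugeboot`, page 1 of every file): the venture produces certified bounds
on lattice expectations at stated coupling, gauge group, dimension and torus size; NOT a mass gap,
NOT a continuum limit, NOT a string tension; NOT Yang–Mills-summit-bearing (barriers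
`FixedCouplingUltralocality`, `PerturbativeInvisibility`). Bookkeeping for the NEGATIVE structural
result `FrameLinkRPNegativeBeta.lean` (link reflection positivity fails at every `β < 0` for
three-dimensional representations of determinant one, e.g. `SU(3)`).

For a periodic lattice `(A, e)` with a site frame `IsSiteFrame e k σ Q h` and its mid-plane
reflection `Θ = configMidReflect e k σ`, a site `x₁` of height `1` and two directions `l, m ≠ k`:

* `posAction` (the positive part `A(U)` of the plaquette sum), **`thetaWitness`**
  `F(U) = Θ_{x₁}(U) · exp(-β A(U))` — the theta observable of the layer `1`
  (`BaryonThetaObservable.lean`) times the inverse positive-half Boltzmann factor; continuity,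
  boundedness, and **`isMidObservable_thetaWitness`**: `F` is an observable of the closed half
  `{1 ≤ h ≤ Q}` (the shape of `IsSiteFrame.linkRP_integral_conj_mul_nonneg`);
* the geometry of the theta graph in the layer `1`: its links have height `1` and directions
  `≠ k` (`height_thetaLink`, `thetaLink_snd_ne`), lie in the block above the lower slab
  (`thetaLink_mem_lowerBlock`, `FrameLowerSlab.lean`); the reflection carries them onto the theta
  links of the layer `0` (`midReflect_of_height_one`: `θ z = z - e_k` on the layer `1`;
  `configMidReflect_thetaLink`); and the slab transfer `t ↦ b_t a_t` reads, on them, the layer-`0`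
  configuration gauge-transformed by the crossing links (`lowerB_mul_lowerA_thetaLink`,
  `Baryon.gaugeAct`).

Everything is `[folklore]` bookkeeping.

References: K. Osterwalder, E. Seiler, Ann. Phys. 110 (1978) 440, §2; M. Creutz, Quarks, Gluons
and Lattices (1983) Ch. 8.
-/

noncomputable section

open MeasureTheory Complex
open scoped Matrix ComplexConjugate ComplexOrder
open Literature.MathematicalPhysics.QuantumFieldTheory (haarProbability)
open Literature.MathematicalPhysics.QuantumFieldTheory.LatticeRP (integral_mul_eq_of_dependsOn
  integral_comp_eq_of_measurePreserving)
open Literature.RepresentationTheory.CompactGroups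

namespace Summit.QuantumFields.GaugeBoot

namespace TiltedRP

open Baryon TwistedSlab

variable {A : Type*} [AddCommGroup A] {d : ℕ}

/-! ## The witness -/

section Witness

variable {G : Type*} [Group G] {N : ℕ} (ρ : G →* Matrix (Fin N) (Fin N) ℂ)
  (e : Fin d → A) (k : Fin d) (Q : ℕ) (h : A →+ ZMod (2 * Q))

open scoped Classical in
/-- The positive part `A(U) = ∑_{p positive} Re tr ρ(U_p)` of the plaquette sum of the mid-plane
reflection (`IsSiteFrame.sum_plaqObs_split_mid`). [folklore] -/
def posAction [Fintype A] (U : Config A d G) : ℝ :=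
  ∑ p ∈ Finset.univ.filter (IsMidPosPlaq k Q h), plaqObs ρ e p U

/-- **The witness**: the theta observable of the layer `h = 1` at `x₁` times the inverse
positive-half Boltzmann factor, `F(U) = Θ_{x₁}(U) · exp(-β A(U))`. [folklore] -/
def thetaWitness [Fintype A] (ρ : G →* Matrix (Fin 3) (Fin 3) ℂ) (β : ℝ) (x₁ : A) (l m : Fin d)
    (U : Config A d G) : ℂ :=
  thetaObs ρ e x₁ l m U * (Real.exp (-(β * posAction ρ e k Q h U)) : ℂ)

variable [Fintype A] [TopologicalSpace G] [IsTopologicalGroup G]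

open scoped Classical in
/-- The positive part of the action is continuous. [folklore] -/
theorem continuous_posAction (hρ : Continuous ρ) : Continuous (posAction (G := G) ρ e k Q h) := by
  unfold posAction
  exact continuous_finsetSum _ fun p _ => continuous_plaqObs ρ hρ e p

/-- The witness is continuous. [folklore] -/
theorem continuous_thetaWitness (ρ : G →* Matrix (Fin 3) (Fin 3) ℂ) (hρ : Continuous ρ) (β : ℝ)
    (x₁ : A) (l m : Fin d) : Continuous (thetaWitness (G := G) e k Q h ρ β x₁ l m) := by
  unfold thetaWitness
  exact (continuous_thetaObs ρ hρ e x₁ l m).mul (continuous_ofReal.comp (Real.continuous_exp.comp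
    ((continuous_const.mul (continuous_posAction ρ e k Q h hρ)).neg)))

/-- The witness is bounded (compact configuration space). [folklore] -/
theorem exists_norm_thetaWitness_le [CompactSpace G] (ρ : G →* Matrix (Fin 3) (Fin 3) ℂ)
    (hρ : Continuous ρ) (β : ℝ) (x₁ : A) (l m : Fin d) :
    ∃ C : ℝ, ∀ U : Config A d G, ‖thetaWitness e k Q h ρ β x₁ l m U‖ ≤ C := by
  obtain ⟨C, hC⟩ := (isCompact_univ.image
    (continuous_thetaWitness e k Q h ρ hρ β x₁ l m)).isBounded.exists_norm_le
  exact ⟨C, fun U => hC _ ⟨U, Set.mem_univ _, rfl⟩⟩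

end Witness

/-! ## Geometry of the theta graph in the layer `1` of a site frame -/

omit [AddCommGroup A] in
/-- The directions of the theta links are `l` or `m`. [folklore] -/
theorem thetaLink_snd_ne [AddCommGroup A] (e : Fin d → A) (x : A) {k l m : Fin d} (hl : l ≠ k)
    (hm : m ≠ k) (r : Fin 7) : (thetaLink e x l m r).2 ≠ k := by
  fin_cases r <;> simpa [thetaLink]

/-- Lowering the base site by `v` lowers every theta link by `v`. [folklore] -/
theorem thetaLink_sub (e : Fin d → A) (x v : A) (l m : Fin d) (r : Fin 7) :
    thetaLink e (x - v) l m r = ((thetaLink e x l m r).1 - v, (thetaLink e x l m r).2) := by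
  fin_cases r <;> simp [thetaLink] <;> abel

namespace IsSiteFrame

variable {e : Fin d → A} {k : Fin d} {σ : A →+ A} {Q : ℕ} {h : A →+ ZMod (2 * Q)}
variable (hF : IsSiteFrame e k σ Q h)
include hF

/-- The theta links at `x` (directions `l, m ≠ k`) have the height of `x`. [folklore] -/
theorem height_thetaLink (x : A) {l m : Fin d} (hl : l ≠ k) (hm : m ≠ k) (r : Fin 7) :
    h (thetaLink e x l m r).1 = h x := by
  fin_cases r <;> simp [thetaLink, map_add, map_sub, hF.height_other l hl, hF.height_other m hm]

/-- **The mid-plane reflection lowers a site of height `1` by `e_k`**: `θ z = z - e_k`. [folklore] -/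
theorem midReflect_of_height_one {z : A} (hz : (h z).val = 1) : midReflect e k σ z = z - e k := by
  have h0 : (h (z - e k)).val = 0 := hF.val_height_sub_self_of_one hz
  have h1 := hF.midReflect_add_self (z - e k)
  rw [sub_add_cancel, hF.map_of_val (Or.inl h0)] at h1
  exact h1

variable {G : Type*} [Group G]

/-- **The reflection maps the theta links of the layer `1` onto those of the layer `0`**:
`(ΘU)(t_r(x₁)) = U(t_r(x₁ - e_k))`. [folklore] -/
theorem configMidReflect_thetaLink {x₁ : A} (hx₁ : (h x₁).val = 1) {l m : Fin d} (hl : l ≠ k)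
    (hm : m ≠ k) (U : Config A d G) (r : Fin 7) :
    configMidReflect e k σ U (thetaLink e x₁ l m r) = U (thetaLink e (x₁ - e k) l m r) := by
  have hne := thetaLink_snd_ne e x₁ hl hm r
  have hz : (h (thetaLink e x₁ l m r).1).val = 1 := by rw [hF.height_thetaLink x₁ hl hm r, hx₁]
  rw [thetaLink_sub, show thetaLink e x₁ l m r = ((thetaLink e x₁ l m r).1, (thetaLink e x₁ l m r).2)
    from rfl, configMidReflect_other e k σ U _ hne, hF.midReflect_of_height_one hz]

/-- The theta links of the layer `1` lie in the block above the lower slab. [folklore] -/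
theorem thetaLink_mem_lowerBlock [Fintype A] {x₁ : A} (hx₁ : (h x₁).val = 1) {l m : Fin d}
    (hl : l ≠ k) (hm : m ≠ k) (r : Fin 7) : thetaLink e x₁ l m r ∈ lowerBlock k Q h :=
  mem_lowerBlock.2 ⟨by rw [hF.height_thetaLink x₁ hl hm r, hx₁], thetaLink_snd_ne e x₁ hl hm r⟩

/-- **The transferred theta links are the gauge-transformed layer-`0` links**: on the theta links
at `x₁`, `b_t(U) a_t(U)` is the configuration `g · U`, `g_z = U(z, k)⁻¹`, read at the theta links
at `x₁ - e_k`. [folklore] -/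
theorem lowerB_mul_lowerA_thetaLink [Fintype A] {x₁ : A} (hx₁ : (h x₁).val = 1) {l m : Fin d}
    (hl : l ≠ k) (hm : m ≠ k) (U : Config A d G) (r : Fin 7) :
    lowerB e k Q h (thetaLink e x₁ l m r) U * lowerA e k Q h (thetaLink e x₁ l m r) U =
      gaugeAct e (fun z => (U (z, k))⁻¹) U (thetaLink e (x₁ - e k) l m r) := by
  have ht : IsLowerBlockLink k Q h (thetaLink e x₁ l m r) :=
    ⟨by rw [hF.height_thetaLink x₁ hl hm r, hx₁], thetaLink_snd_ne e x₁ hl hm r⟩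
  rw [lowerB_mul_lowerA ht, thetaLink_sub,
    show gaugeAct e (fun z => (U (z, k))⁻¹) U ((thetaLink e x₁ l m r).1 - e k, (thetaLink e x₁ l m r).2)
      = (U ((thetaLink e x₁ l m r).1 - e k, k))⁻¹ * U ((thetaLink e x₁ l m r).1 - e k,
          (thetaLink e x₁ l m r).2) * ((U ((thetaLink e x₁ l m r).1 - e k +
            e (thetaLink e x₁ l m r).2, k))⁻¹)⁻¹ from rfl, inv_inv]

/-! ## The witness is a bounded continuous half observable -/

variable [Fintype A] {N : ℕ}

open scoped Classical in
/-- The positive part of the action depends only on positive links. [folklore] -/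
theorem posAction_congr (ρ' : G →* Matrix (Fin N) (Fin N) ℂ) {U V : Config A d G}
    (hUV : ∀ t, IsMidPosLink e Q h t → U t = V t) :
    posAction ρ' e k Q h U = posAction ρ' e k Q h V :=
  hF.sum_pos_congr ρ' hUV

variable (ρ : G →* Matrix (Fin 3) (Fin 3) ℂ)

/-- **The witness is a half observable** of the closed half `{1 ≤ h ≤ Q}`. [folklore] -/
theorem isMidObservable_thetaWitness {x₁ : A} (hx₁ : (h x₁).val = 1) {l m : Fin d} (hl : l ≠ k)
    (hm : m ≠ k) (β : ℝ) : IsMidObservable e Q h (thetaWitness (G := G) e k Q h ρ β x₁ l m) := by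
  intro U V hUV
  have hQ := hF.two_le
  unfold thetaWitness
  rw [hF.posAction_congr ρ hUV, thetaObs_congr ρ (x' := x₁) (V' := V) fun r => hUV _ ?_]
  rw [show thetaLink e x₁ l m r = ((thetaLink e x₁ l m r).1, (thetaLink e x₁ l m r).2) from rfl]
  have h1 : (h (thetaLink e x₁ l m r).1).val = 1 := by rw [hF.height_thetaLink x₁ hl hm r, hx₁]
  exact hF.isMidPosLink_other (thetaLink_snd_ne e x₁ hl hm r) (by omega) (by omega)

end IsSiteFrame

end TiltedRP

end Summit.QuantumFields.GaugeBoot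

end
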